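import Summits.QuantumFields.QCD.Theses.HeatSlicedQuarks
import Summits.QuantumFields.QCD.Theses.GradientFlowSpecies
import Summits.QuantumFields.QCD.Theorems.RobustYangMillsHandover.Negative.ChiralityObstruction

/-!
# Crux idea `pin-the-infimum` — first lemma (crux-ideate round 2, ideator 4, 2026-08-16)

Crux `stmt-QuantumFields-8892`, `HeatSlicedQuarks.RobustYangMillsHandover := ContinuumQCDExists → QCD`,
after the statement re-type p117723 (`QCDOf` conjoins `reg.IsChiralAtZero`).

THE PIN.  For a regularisation `reg` (think: the one X₀ hands over) let

  `gappedOffsets reg := {M : ℝ | every offset tuple t with all t_f > M is lattice-gapped at SOME rate}`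

(an up-set of ℝ by definition) and `P := sInf (gappedOffsets reg)`.  Shift `m_crit` by `P`
(`shiftReg reg P`: renormalised masses `m` of the shifted regularisation are the offsets `P + m` of `reg`).
Then (theorem `pin`, pure logic over the tree's definitions, no sorry):

* every positive tuple of `shiftReg reg P` is lattice-gapped — BY DEFINITION of the infimum of an up-set;
* `shiftReg reg P` IS CHIRAL AT ZERO as soon as `reg` "opens below" (`OpensBelow reg`: a UNIFORM lattice gap
  `ε` on the half-line of tuples above an offset `M` forces pointwise gaps on a slab of tuples just below `M`):
  a uniform rate above `P` would put `P − δ/2` into `gappedOffsets reg`, contradicting `P = sInf`.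

So the light-quark content the re-type moved into the crux is reduced to three inputs on X₀'s own offset axis:
`(gappedOffsets reg).Nonempty` (the OLD heavy-threshold lattice half, pointwise form = `QCDOfAboveThreshold`'s
lattice clause, what every round-1 line delivers), `BddBelow (gappedOffsets reg)` (⟸ one fixed offset tuple is
NOT lattice-gapped: the weakest Goldstone input, exactly where X₀'s non-triviality must be spent), and
`OpensBelow reg` (mass-robustness of a uniform lattice gap under a small DECREASE of the flavour-blind
renormalised offset: Feynman–Hellmann / sigma-term Lipschitz response in a gapped theory).  `qcdOf_of_pin`
assembles `QCDOf Nf` from the pin plus honest gapped continuum data on the gapped half-line, and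
`robustYangMillsHandover_of_pin` closes the crux BY NAME from the per-`N_f` package.

Contrast with the dead head of all 12 round-1 lines: they shifted `m_crit` by an ARBITRARY threshold `M₀` inside
the gapped half-line — provably non-chiral (`Negative.not_isChiralAtZero_mcrit_shift_of_uniformGapAbove`); the
infimum is the unique shift at which that obstruction's hypothesis is equivalent to `¬ OpensBelow`.
-/

namespace Summit.QuantumFields.QCD.Cruxes.RobustYangMillsHandover.PinTheInfimum

open Summit.QuantumFields.QCD.Theses.HeatSlicedQuarks
open Summit.QuantumFields.QCD.Theorems.RobustYangMillsHandover.Negative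
open Literature.MathematicalPhysics.QuantumFieldTheory
open Filter

variable {Nf : ℕ}

/-! ## Definitions -/

/-- The lattice theory of `reg` at the offset tuple `t` is gapped at SOME positive uniform rate. -/
def LatticeGappedAt (reg : QCDRegularisation Nf) (t : Fin Nf → ℝ) : Prop :=
  ∃ Δ > (0 : ℝ), (reg.scheme t 0 0).HasLatticeMassGap Δ

/-- The set of offsets `M` above which EVERY tuple is lattice-gapped (pointwise rates). An up-set by definition. -/
def gappedOffsets (reg : QCDRegularisation Nf) : Set ℝ :=
  {M | ∀ t : Fin Nf → ℝ, (∀ f, M < t f) → LatticeGappedAt reg t}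

/-- The `m_crit`-shift by the renormalised offset `M` (masses `m` of the shift are offsets `M + m` of `reg`). -/
noncomputable def shiftReg (reg : QCDRegularisation Nf) (M : ℝ) : QCDRegularisation Nf :=
  { reg with mcrit := fun k => reg.mcrit k + reg.a k * M / reg.Zm k }

/-- **OPENS BELOW** (the new stub this idea bets on): a UNIFORM lattice gap `ε` at every tuple above the offset
`M` forces SOME positive rate at every tuple of a slab just below `M`.  Mechanism: Feynman–Hellmann response
`∂_M ⟨A·B⟩ = −∫⟨A·B ; S_R⟩` with the renormalised singlet scalar density `S_R = (a/Z_m) ψ̄ψ`; one insertion, so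
pair/diameter clustering at rate `ε` bounds the response and the gap is Lipschitz in the flavour-blind offset with
constant `C(ε)`, hence cannot drop from `≥ ε` to `0` instantly. -/
def OpensBelow (reg : QCDRegularisation Nf) : Prop :=
  ∀ M : ℝ, (∃ ε > (0 : ℝ), ∀ t : Fin Nf → ℝ, (∀ f, M < t f) → (reg.scheme t 0 0).HasLatticeMassGap ε) →
    ∃ δ > (0 : ℝ), ∀ t : Fin Nf → ℝ, (∀ f, M - δ < t f) → LatticeGappedAt reg t

/-- The degenerate (flavour-symmetric) offset tuple `(μ, …, μ)`. -/
def diag (Nf : ℕ) (μ : ℝ) : Fin Nf → ℝ := fun _ => μ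

/-- **Stub DiagDom — pointwise diagonal domination** (a comparison principle, weaker than the rate-preserving
monotonicity `QuarkMassMonotone.LatticeGapMonotone`, stmt-QuantumFields-8905): if every DEGENERATE offset tuple above
`M` is lattice-gapped then every offset tuple above `M` is — splitting the masses upward above a gapped flavour-symmetric
floor never closes the lattice gap (heavier flavours only raise the induced scales; no transition at positive masses,
Vafa–Witten). This is where the hierarchy corner of FINDING-thresholds-ratios is discharged. -/
def DiagDom (reg : QCDRegularisation Nf) : Prop :=
  ∀ M : ℝ, (∀ μ : ℝ, M < μ → LatticeGappedAt reg (diag Nf μ)) → ∀ t : Fin Nf → ℝ, (∀ f, M < t f) → LatticeGappedAt reg t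

/-- **Stub Open — DIAGONAL RESPONSE (the bet; Feynman–Hellmann on the one-parameter degenerate family):** for every rate
`ε` there is `δ(ε) > 0` such that, for every offset `M`, a uniform lattice gap `ε` of the degenerate theories at all
offsets `μ > M` forces the rate `ε/2` at all degenerate offsets `μ > M − δ`.  Along the degenerate ray the lightest state
responds to the flavour-blind mass with ONE sigma term per point (no hierarchy), `|∂_μ rate| ≤ C(ε)` while `rate ≥ ε/2`,
so `δ(ε) = ε/(2C(ε))` (GMOR size `≈ ε²/B`).  Content beyond chirality: the degenerate gap profile has a uniform modulus of
continuity on the whole ray (no first-order jump of the `T = 0` gap in the common quark mass). -/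
def DiagonalResponse (reg : QCDRegularisation Nf) : Prop :=
  ∀ ε > (0 : ℝ), ∃ δ > (0 : ℝ), ∀ M : ℝ,
    (∀ μ : ℝ, M < μ → (reg.scheme (diag Nf μ) 0 0).HasLatticeMassGap ε) →
      ∀ μ : ℝ, M - δ < μ → (reg.scheme (diag Nf μ) 0 0).HasLatticeMassGap (ε / 2)

/-! ## Elementary facts -/

/-- `gappedOffsets` is an up-set. [folklore] -/
theorem gappedOffsets_upper {reg : QCDRegularisation Nf} {M M' : ℝ} (hM : M ∈ gappedOffsets reg)
    (h : M ≤ M') : M' ∈ gappedOffsets reg :=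
  fun t ht => hM t fun f => lt_of_le_of_lt h (ht f)

/-- The shifted scheme at `m` is the original scheme at `M + m`. [folklore] -/
theorem shiftReg_scheme (reg : QCDRegularisation Nf) (M : ℝ) (m : Fin Nf → ℝ)
    (z shift : QCDField Nf → ℕ → ℝ) :
    (shiftReg reg M).scheme m z shift = reg.scheme (fun f => M + m f) z shift := by
  simp only [QCDRegularisation.scheme, shiftReg, QCDScheme.mk.injEq, true_and, and_true]
  funext f k
  ring

/-- The shift keeps `HasMassScaling` (which never reads `m_crit`). [folklore] -/
theorem shiftReg_hasMassScaling_iff (reg : QCDRegularisation Nf) (M : ℝ) :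
    (shiftReg reg M).HasMassScaling ↔ reg.HasMassScaling :=
  Iff.rfl

/-- A finite tuple of positive reals has a positive lower bound. [folklore] -/
theorem exists_pos_le_all (m : Fin Nf → ℝ) (hm : ∀ f, 0 < m f) : ∃ δ > (0 : ℝ), ∀ f, δ ≤ m f := by
  rcases isEmpty_or_nonempty (Fin Nf) with hE | hN
  · exact ⟨1, one_pos, fun f => (hE.false f).elim⟩
  · obtain ⟨f₀, -, hf₀⟩ := Finset.exists_min_image Finset.univ m Finset.univ_nonempty
    exact ⟨m f₀, hm f₀, fun f => hf₀ f (Finset.mem_univ f)⟩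

/-- Monotonicity of the lattice gap clause in the rate. [folklore] -/
theorem hasLatticeMassGap_anti (sch : QCDScheme Nf) {Δ Δ' : ℝ} (hle : Δ ≤ Δ')
    (h : sch.HasLatticeMassGap Δ') : sch.HasLatticeMassGap Δ := by
  intro R R' A B
  obtain ⟨C, hC⟩ := h R R' A B
  refine ⟨C, ?_⟩
  filter_upwards [hC] with k hk S hS n hn
  refine (hk S hS n hn).trans ?_
  have hC0 : 0 ≤ C := by
    have h1 := (norm_nonneg _).trans (hk S hS n hn)
    exact nonneg_of_mul_nonneg_left h1 (Real.exp_pos _)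
  refine mul_le_mul_of_nonneg_left (Real.exp_le_exp.mpr ?_) hC0
  have : 0 ≤ sch.a k * n := mul_nonneg (sch.a_pos k).le (Nat.cast_nonneg n)
  nlinarith

/-- Monotonicity of the continuum gap clause in the rate. [folklore] -/
theorem hasMassGap_anti {ι : Type} {d : ℕ} [NeZero d] (T : OSData ι d) {Δ Δ' : ℝ} (hle : Δ ≤ Δ')
    (h : T.HasMassGap Δ') : T.HasMassGap Δ := by
  intro n m k k' F G hF hG
  obtain ⟨C, hC⟩ := h n m k k' F G hF hG
  refine ⟨C, fun t ht H hH => (hC t ht H hH).trans ?_⟩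
  have hC0 : 0 ≤ C := by
    have h1 := (norm_nonneg _).trans (hC t ht H hH)
    exact nonneg_of_mul_nonneg_left h1 (Real.exp_pos _)
  exact mul_le_mul_of_nonneg_left (Real.exp_le_exp.mpr (by nlinarith)) hC0

/-- **Openness below from the two diagonal stubs** (so `OpensBelow` is a derived notion of this idea, not an input):
uniform `ε` above `M` ⇒ uniform `ε` on the diagonal above `M` ⇒ (`DiagonalResponse`) rate `ε/2` on the diagonal above
`M − δ` ⇒ (`DiagDom`) every tuple above `M − δ` is lattice-gapped. [folklore] -/
theorem opensBelow_of_diagonal (reg : QCDRegularisation Nf) (hdom : DiagDom reg) (hresp : DiagonalResponse reg) :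
    OpensBelow reg := by
  intro M hM
  obtain ⟨ε, hε, hgap⟩ := hM
  obtain ⟨δ, hδ, hδresp⟩ := hresp ε hε
  refine ⟨δ, hδ, hdom (M - δ) fun μ hμ => ?_⟩
  have h := hδresp M (fun μ' hμ' => hgap (diag Nf μ') fun _ => hμ') μ hμ
  exact ⟨ε / 2, by positivity, h⟩

/-! ## The pin lemma -/

/-- **Gaps above the pin are free.** If `gappedOffsets reg` is non-empty, every positive tuple of the
regularisation shifted by its infimum is lattice-gapped — by the definition of the infimum of an up-set (if the
up-set is all of `ℝ` the infimum is Lean's junk `0` and the conclusion holds a fortiori). [folklore] -/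
theorem pin_latticeGapped (reg : QCDRegularisation Nf) (hne : (gappedOffsets reg).Nonempty)
    (m : Fin Nf → ℝ) (hm : ∀ f, 0 < m f) :
    LatticeGappedAt (shiftReg reg (sInf (gappedOffsets reg))) m := by
  set P := sInf (gappedOffsets reg) with hP
  obtain ⟨δ, hδ, hδm⟩ := exists_pos_le_all m hm
  -- some gapped offset lies strictly below `P + δ`
  obtain ⟨M, hMS, hMlt⟩ := exists_lt_of_csInf_lt hne (show P < P + δ by linarith)
  have hgap : LatticeGappedAt reg (fun f => P + m f) :=
    hMS _ fun f => by linarith [hδm f]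
  obtain ⟨Δ, hΔ, hL⟩ := hgap
  refine ⟨Δ, hΔ, ?_⟩
  rw [shiftReg_scheme]
  exact hL

/-- **Chirality at the pin.** If moreover `reg` opens below, the regularisation shifted by the infimum of its gapped
offsets IS chiral at zero: a uniform rate `ε` above `P = sInf` would, by `OpensBelow`, gap a slab below `P`, putting
`P − δ/2` into the up-set — below its own infimum. [folklore] -/
theorem pin_isChiralAtZero (reg : QCDRegularisation Nf) (hbdd : BddBelow (gappedOffsets reg))
    (hopen : OpensBelow reg) : (shiftReg reg (sInf (gappedOffsets reg))).IsChiralAtZero := by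
  set P := sInf (gappedOffsets reg) with hP
  intro ε hε
  by_contra hcon
  push Not at hcon
  -- `hcon : ∀ m, (∀ f, 0 < m f) → (shifted scheme at m).HasLatticeMassGap ε` — a uniform gap above `P`
  have huni : ∀ t : Fin Nf → ℝ, (∀ f, P < t f) → (reg.scheme t 0 0).HasLatticeMassGap ε := by
    intro t ht
    have h := hcon (fun f => t f - P) (fun f => by linarith [ht f])
    rw [shiftReg_scheme] at h
    have ht' : (fun f => P + (t f - P)) = t := funext fun f => by ring
    rwa [ht'] at h
  obtain ⟨δ, hδ, hslab⟩ := hopen P ⟨ε, hε, huni⟩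
  -- the slab puts `P - δ/2` into the up-set
  have hmem : P - δ / 2 ∈ gappedOffsets reg :=
    fun t ht => hslab t fun f => by linarith [ht f]
  have := csInf_le hbdd hmem
  linarith

/-- **THE PIN LEMMA** (first lemma of the idea): non-empty + bounded-below gapped offsets and openness below give a
regularisation with mass scaling untouched, chiral at zero, and lattice-gapped at every positive tuple. [folklore] -/
theorem pin (reg : QCDRegularisation Nf) (hne : (gappedOffsets reg).Nonempty)
    (hbdd : BddBelow (gappedOffsets reg)) (hopen : OpensBelow reg) :
    (shiftReg reg (sInf (gappedOffsets reg))).IsChiralAtZero ∧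
      ∀ m : Fin Nf → ℝ, (∀ f, 0 < m f) → LatticeGappedAt (shiftReg reg (sInf (gappedOffsets reg))) m :=
  ⟨pin_isChiralAtZero reg hbdd hopen, pin_latticeGapped reg hne⟩

/-- A single NON-gapped offset tuple bounds the gapped offsets below (the form in which the Goldstone input is
consumed: "at some fixed renormalised offset of X₀'s regularisation no positive lattice rate survives `k → ∞`").
[folklore] -/
theorem bddBelow_of_not_latticeGappedAt (reg : QCDRegularisation Nf) {t₀ : Fin Nf → ℝ}
    (h : ¬ LatticeGappedAt reg t₀) : BddBelow (gappedOffsets reg) := by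
  -- any strict lower bound of the components of `t₀` is a lower bound of the up-set
  obtain ⟨L, hL⟩ : ∃ L : ℝ, ∀ f, L < t₀ f := by
    rcases isEmpty_or_nonempty (Fin Nf) with hE | hN
    · exact ⟨0, fun f => (hE.false f).elim⟩
    · obtain ⟨f₀, -, hf₀⟩ := Finset.exists_min_image Finset.univ t₀ Finset.univ_nonempty
      exact ⟨t₀ f₀ - 1, fun f => by linarith [hf₀ f (Finset.mem_univ f)]⟩
  refine ⟨L, fun M hM => ?_⟩
  by_contra hlt
  push Not at hlt
  exact h (hM t₀ fun f => lt_trans hlt (hL f))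

/-- **The heavy input is an EXISTING item.** `GradientFlowSpecies.MassiveLatticeGap` (stmt-QuantumFields-8922 —
what the registered gen-4 two-scale skeleton proves as `massiveLatticeGap_of_stubs` modulo its heavy stubs, and
the lattice half of every round-1 line) says precisely that the gapped offsets of an X₀-honest regularisation are
non-empty. [folklore] -/
theorem gappedOffsets_nonempty_of_massiveLatticeGap
    (h : Summit.QuantumFields.QCD.Theses.GradientFlowSpecies.MassiveLatticeGap) (hNf : Nf = 2 ∨ Nf = 3)
    (reg : QCDRegularisation Nf) (hMS : reg.HasMassScaling)
    (hX : ∀ m : Fin Nf → ℝ, (∀ f, 0 < m f) →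
      ∃ (z shift : QCDField Nf → ℕ → ℝ) (T : OSData (QCDField Nf) 4),
        IsQCDAlong (reg.scheme m z shift) T ∧ T.IsNontrivial QCDField.glue ∧ T.IsNonGaussian QCDField.glue ∧
          ∀ f g : Fin Nf, f ≠ g → T.IsNontrivial (QCDField.pseudoRe f g)) :
    (gappedOffsets reg).Nonempty := by
  obtain ⟨M, hM⟩ := h Nf hNf reg ⟨hMS, hX⟩
  exact ⟨M, fun t ht => hM t ht⟩

/-! ## Assembly: `QCDOf Nf` from the pin, and the crux by name -/

/-- **Honest gapped continuum data on the gapped half-line** (owed per offset tuple above the pin `P`): species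
renormalisations and OS data with `IsQCDAlong`, the three non-triviality clauses and a continuum mass gap.  For tuples
with all offsets `> 0` the existence part is X₀ itself; the continuum gap is the transfer
(`IsQCDAlong.hasMassGap_of_hasSpeciesCSClustering`); tuples with an offset in `(P, 0]` occur only in the non-chiral
branch of X₀'s regularisation. -/
def HonestGappedDataAbove (reg : QCDRegularisation Nf) (P : ℝ) : Prop :=
  ∀ t : Fin Nf → ℝ, (∀ f, P < t f) →
    ∃ (z shift : QCDField Nf → ℕ → ℝ) (T : OSData (QCDField Nf) 4),
      IsQCDAlong (reg.scheme t z shift) T ∧ T.IsNontrivial QCDField.glue ∧ T.IsNonGaussian QCDField.glue ∧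
        (∀ f g : Fin Nf, f ≠ g → T.IsNontrivial (QCDField.pseudoRe f g)) ∧ ∃ Δ > 0, T.HasMassGap Δ

/-- Every tuple strictly above the infimum of the (non-empty) gapped offsets is lattice-gapped. [folklore] -/
theorem latticeGappedAt_of_above_sInf (reg : QCDRegularisation Nf) (hne : (gappedOffsets reg).Nonempty)
    (t : Fin Nf → ℝ) (ht : ∀ f, sInf (gappedOffsets reg) < t f) : LatticeGappedAt reg t := by
  obtain ⟨δ, hδ, hδm⟩ := exists_pos_le_all (fun f => t f - sInf (gappedOffsets reg)) (fun f => by linarith [ht f])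
  obtain ⟨M, hMS, hMlt⟩ := exists_lt_of_csInf_lt hne (show sInf (gappedOffsets reg) < sInf (gappedOffsets reg) + δ by
    linarith)
  exact hMS t fun f => by linarith [hδm f]

/-- **X₀'s data above zero.** -/
def HonestDataAboveZero (reg : QCDRegularisation Nf) : Prop :=
  ∀ m : Fin Nf → ℝ, (∀ f, 0 < m f) →
    ∃ (z shift : QCDField Nf → ℕ → ℝ) (T : OSData (QCDField Nf) 4),
      IsQCDAlong (reg.scheme m z shift) T ∧ T.IsNontrivial QCDField.glue ∧ T.IsNonGaussian QCDField.glue ∧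
        ∀ f g : Fin Nf, f ≠ g → T.IsNontrivial (QCDField.pseudoRe f g)

/-- **Stub E (non-chiral branch only): honest data at the gapped offsets of `reg` that are NOT all positive** —
vacuous when the pin `P ≥ 0` (e.g. when the non-gapped tuple of stub Below has non-negative components). -/
def HonestDataBelowZero (reg : QCDRegularisation Nf) (P : ℝ) : Prop :=
  ∀ t : Fin Nf → ℝ, (∀ f, P < t f) → (∃ f, t f ≤ 0) →
    ∃ (z shift : QCDField Nf → ℕ → ℝ) (T : OSData (QCDField Nf) 4),
      IsQCDAlong (reg.scheme t z shift) T ∧ T.IsNontrivial QCDField.glue ∧ T.IsNonGaussian QCDField.glue ∧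
        ∀ f g : Fin Nf, f ≠ g → T.IsNontrivial (QCDField.pseudoRe f g)

/-- **Stub T: continuum gap of a lattice-gapped honest scheme** (transfer; output in the weakest `∃ Δ` form — the
prover of the lattice gap may equally deliver `HasSpeciesCSClustering` and use the landed
`IsQCDAlong.hasMassGap_of_hasSpeciesCSClustering`; cf. Disproof §13 on per-pair constants). -/
def ContinuumGapTransfer (reg : QCDRegularisation Nf) : Prop :=
  ∀ (t : Fin Nf → ℝ) (z shift : QCDField Nf → ℕ → ℝ) (T : OSData (QCDField Nf) 4),
    IsQCDAlong (reg.scheme t z shift) T → LatticeGappedAt reg t → ∃ Δ > 0, T.HasMassGap Δ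

/-- The data package above the pin splits into X₀'s data, stub E and stub T. [folklore] -/
theorem honestGappedDataAbove_of_split (reg : QCDRegularisation Nf) (hne : (gappedOffsets reg).Nonempty)
    (hX : HonestDataAboveZero reg) (hE : HonestDataBelowZero reg (sInf (gappedOffsets reg)))
    (hT : ContinuumGapTransfer reg) : HonestGappedDataAbove reg (sInf (gappedOffsets reg)) := by
  intro t ht
  have hL : LatticeGappedAt reg t := latticeGappedAt_of_above_sInf reg hne t ht
  by_cases hpos : ∀ f, 0 < t f
  · obtain ⟨z, shift, T, hA, hN, hG, hP⟩ := hX t hpos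
    obtain ⟨Δ, hΔ, hTg⟩ := hT t z shift T hA hL
    exact ⟨z, shift, T, hA, hN, hG, hP, Δ, hΔ, hTg⟩
  · push Not at hpos
    obtain ⟨z, shift, T, hA, hN, hG, hP⟩ := hE t ht hpos
    obtain ⟨Δ, hΔ, hTg⟩ := hT t z shift T hA hL
    exact ⟨z, shift, T, hA, hN, hG, hP, Δ, hΔ, hTg⟩

/-- **`QCDOf Nf` from the pin.** [folklore] -/
theorem qcdOf_of_pin (reg : QCDRegularisation Nf) (hMS : reg.HasMassScaling)
    (hne : (gappedOffsets reg).Nonempty) (hbdd : BddBelow (gappedOffsets reg)) (hopen : OpensBelow reg)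
    (hdata : HonestGappedDataAbove reg (sInf (gappedOffsets reg))) : QCDOf Nf := by
  set P := sInf (gappedOffsets reg) with hP
  refine ⟨shiftReg reg P, (shiftReg_hasMassScaling_iff reg P).mpr hMS, pin_isChiralAtZero reg hbdd hopen,
    fun m hm => ?_⟩
  obtain ⟨z, shift, T, hA, hN, hG, hPs, Δ₁, hΔ₁, hT⟩ := hdata (fun f => P + m f) (fun f => by linarith [hm f])
  obtain ⟨Δ₂, hΔ₂, hL⟩ := pin_latticeGapped reg hne m hm
  refine ⟨z, shift, T, ?_, hN, hG, hPs, min Δ₁ Δ₂, lt_min hΔ₁ hΔ₂, hasMassGap_anti T (min_le_left _ _) hT, ?_⟩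
  · rw [shiftReg_scheme]; exact hA
  · exact (hasLatticeMassGap_species_irrel _ m z shift _).mpr (hasLatticeMassGap_anti _ (min_le_right _ _) hL)

/-- **The per-flavour-number package the line owes** for the regularisation X₀ hands over at `N_f`. -/
def PinPackage (Nf : ℕ) : Prop :=
  ∀ reg : QCDRegularisation Nf, reg.HasMassScaling →
    (∀ m : Fin Nf → ℝ, (∀ f, 0 < m f) →
      ∃ (z shift : QCDField Nf → ℕ → ℝ) (T : OSData (QCDField Nf) 4),
        IsQCDAlong (reg.scheme m z shift) T ∧ T.IsNontrivial QCDField.glue ∧ T.IsNonGaussian QCDField.glue ∧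
          ∀ f g : Fin Nf, f ≠ g → T.IsNontrivial (QCDField.pseudoRe f g)) →
    (gappedOffsets reg).Nonempty ∧ BddBelow (gappedOffsets reg) ∧ OpensBelow reg ∧
      HonestGappedDataAbove reg (sInf (gappedOffsets reg))

/-- **The crux BY NAME from the packages at `N_f = 2, 3`.** [folklore] -/
theorem robustYangMillsHandover_of_pin (h2 : PinPackage 2) (h3 : PinPackage 3) : RobustYangMillsHandover := by
  intro hX
  have key : ∀ Nf, (Nf = 2 ∨ Nf = 3) → PinPackage Nf → QCDOf Nf := by
    intro Nf hNf hP
    obtain ⟨reg, hMS, hb⟩ := hX Nf hNf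
    obtain ⟨hne, hbdd, hopen, hdata⟩ := hP reg hMS hb
    exact qcdOf_of_pin reg hMS hne hbdd hopen hdata
  exact ⟨key 2 (Or.inl rfl) h2, key 3 (Or.inr rfl) h3⟩

/-- **Transparency: weak openness IS chirality at the pin.** With non-empty, bounded-below gapped offsets,
`OpensBelow reg` holds iff there is NO uniform lattice rate at the tuples above the infimum — its only non-automatic
instance is `M = sInf` (for `M` above the infimum the conclusion holds by `latticeGappedAt_of_above_sInf`, for `M` below
it the hypothesis fails).  Hence the idea does NOT file `OpensBelow` as a stub (it would be the stuck goal re-typed); it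
files the strictly stronger, mechanism-carrying `DiagonalResponse` + `DiagDom` (`opensBelow_of_diagonal`). [folklore] -/
theorem opensBelow_iff_noUniformRateAbovePin (reg : QCDRegularisation Nf) (hne : (gappedOffsets reg).Nonempty)
    (hbdd : BddBelow (gappedOffsets reg)) :
    OpensBelow reg ↔
      ¬ ∃ ε > (0 : ℝ), ∀ t : Fin Nf → ℝ, (∀ f, sInf (gappedOffsets reg) < t f) →
        (reg.scheme t 0 0).HasLatticeMassGap ε := by
  set P := sInf (gappedOffsets reg) with hP
  constructor
  · rintro hopen ⟨ε, hε, huni⟩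
    obtain ⟨δ, hδ, hslab⟩ := hopen P ⟨ε, hε, huni⟩
    have hmem : P - δ / 2 ∈ gappedOffsets reg := fun t ht => hslab t fun f => by linarith [ht f]
    have := csInf_le hbdd hmem
    linarith
  · intro hno M hM
    obtain ⟨ε, hε, hgap⟩ := hM
    rcases le_or_gt M P with hle | hlt
    · -- below or at the infimum the hypothesis already gives a uniform rate above `P`: excluded
      exact absurd ⟨ε, hε, fun t ht => hgap t fun f => lt_of_le_of_lt hle (ht f)⟩ hno
    · -- strictly above the infimum the conclusion is automatic
      refine ⟨(M - P) / 2, by linarith, fun t ht => latticeGappedAt_of_above_sInf reg hne t fun f => ?_⟩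
      linarith [ht f]

/-- **The package in the form the stubs are filed** (diagonal response + domination + one non-gapped degenerate tuple +
the old heavy half + data split). -/
def PinPackageDiag (Nf : ℕ) : Prop :=
  ∀ reg : QCDRegularisation Nf, reg.HasMassScaling → HonestDataAboveZero reg →
    (gappedOffsets reg).Nonempty ∧ (∃ μ₀ : ℝ, ¬ LatticeGappedAt reg (diag Nf μ₀)) ∧ DiagDom reg ∧ DiagonalResponse reg ∧
      HonestDataBelowZero reg (sInf (gappedOffsets reg)) ∧ ContinuumGapTransfer reg

/-- The filed package implies the abstract one. [folklore] -/
theorem pinPackage_of_diag (h : PinPackageDiag Nf) : PinPackage Nf := by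
  intro reg hMS hX
  obtain ⟨hne, ⟨μ₀, hμ₀⟩, hdom, hresp, hE, hT⟩ := h reg hMS hX
  exact ⟨hne, bddBelow_of_not_latticeGappedAt reg hμ₀, opensBelow_of_diagonal reg hdom hresp,
    honestGappedDataAbove_of_split reg hne hX hE hT⟩

/-- **The crux BY NAME from the filed packages at `N_f = 2, 3`** (stubs: H = 8922-shape non-emptiness, Below = one
non-gapped degenerate tuple, DiagDom, DiagonalResponse, E, T). [folklore] -/
theorem robustYangMillsHandover_of_diag (h2 : PinPackageDiag 2) (h3 : PinPackageDiag 3) : RobustYangMillsHandover :=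
  robustYangMillsHandover_of_pin (pinPackage_of_diag h2) (pinPackage_of_diag h3)

end Summit.QuantumFields.QCD.Cruxes.RobustYangMillsHandover.PinTheInfimum
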